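import Summits.QuantumFields.BalabanUV.Beta.D1BFx.TorusScalarAveraging
import Summits.QuantumFields.BalabanUV.Beta.D1BFx.TorusGhostLegs
import Summits.QuantumFields.BalabanUV.Beta.D1BFx.TorusGhostGram
import Summits.QuantumFields.BalabanUV.Beta.D1BFx.TorusGaugeWeight

/-!
# `BalabanUV.Beta.D1BFx.TorusScalarCoarseGram` — road «BF-x», binder row D1, slot (K), X₃(ii) ROUTE T, brick **K-TB3c PART 2, FILE 2∕2**
# «THE COARSE GRAM OF THE SCALAR TOWER ON THE TORUS — THE `S₀`-LETTER»: **`Qind·Ĝ′·Ĝ′·Qindᵀ = (m+1)⁴ • k̂erSq`** (the scalar twin of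
# `TorusAveragingGram.Qhat_mul_Ghat_mul_QhatT`), `(ÂX·ÂX)⁻¹ = Ĝ′·Ĝ′`, hence **`S₀ := Qind·(ÂX·ÂX)⁻¹·Qindᵀ = (m+1)⁴ • k̂erSq`**, the coarse letter
# `k̂erSq·Ĉsq = 1 = Ĉsq·k̂erSq` on EVERY coarse torus, **`S₀ · ((m+1)⁻⁴ • Ĉsq) = 1`**, `det S₀ ≠ 0`, `S₀⁻¹ = (m+1)⁻⁴ • Ĉsq` — the `hS₀`∕`hGs`∕`hS` data of
# `GhostSplitJets.hessT_kkt_sq_jets(_of_mul_eq_one)` at `U = 1` — and the same letters in K-TB3c PART 1's `× Unit` ∕ road-`n` currency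
# (`TorusGhostLegs.Ggh^`, `TorusGhostGram.KsqK^ ∕ CsqK^`): **`QindU·(Ggh)^·(Ggh)^·QindUᵀ = n⁴ • (KsqK)^`**, `· (n⁻⁴ • (CsqK)^) = 1`.
# FILE 1∕2 = `D1BFx/TorusScalarAveraging` (`Qind`, the two-scale unfold).

HONEST DEPENDENCY (cell records, verbatim): «continuum YM on T⁴ ⇐ BetaPertH ∧ nine spine estimates (0/9 proved); BetaPertH ⇐ (D1) ∧ (D4) ∧
CAP+tail; G-an2-4 gates asym, D1 and NE2/3/4.»  HONEST FRAMING (cell contract, verbatim): «discharging `BetaPertH` makes Bałaban's UV stability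
UNCONDITIONAL — a real constructive-QFT result; it is NOT the continuum limit and NOT the Clay problem.»  THIS MODULE DISCHARGES NOTHING of (K),
of D1 or of the wall: [folklore] lattice bookkeeping over an4's `EntrywiseVolumeLimit` (`periodise₂_compKer`, `lemma222_periodic`, `periodise₂_const_mul`,
`IsPeriodic₂.of_transInv`), pv23's `B6QGGQ278Zd` (`kerSq`, `Csq`, `abs_kerSq_le`, `abs_Csq_le`, `kerSq_symm`) and `B5Hk103ScalarZd` (`Gk`, `gq`), the D1
lineage's `RProjector` (`tsum_kerSq_mul_Csq`, `Csq_symm`), `RProjectorRange.Gk_symm`, `RJetProjector` (`kerSq_translate`, `Csq_translate`), `PeriodisedKernels`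
(`isPeriodic₂_Gk`, `rowBound_Gk`, `rowBound_of_site_decay`, `periodise₂_symm`), `PeriodisedProjector` (`Ghat`, `AXhat`, `Ghat_mul_AXhat`), leaf-03's
`FibredPeriodisation` (`periodiseF`, `isPeriodic₂_compKer`, `summable_compKer`), TA2 `PeriodicArrays.toF`, the typer's `GhostLeg.Ggh`, ne9-leaf-09's K-TB3c PART 1
(`TorusGhostLegs.periodiseF_Ggh_eq_submatrix`, `TorusGhostGram.KsqK`∕`CsqK`∕`periodiseF_KsqK_mul_CsqK`), the owner's `TorusGaugeWeight.Lhat_transpose`,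
`GhostLeg.cast_pred_add_one`, and FILE 1 — all USED BY NAME.  Two data
definitions [our object] (`kerSqHat`, `CsqHat`) and two abbreviations (`eU`, `QindU`); no `def … : Prop`, nothing cited, 0 sorry.  NOT D1, NOT BetaPertH,
NOT continuum, NOT Clay.

ABSOLUTE RULE (cell charter, verbatim): «No internally-minted statement may enter as a cited fact. Every hypothesis is either kernel-proved in this
package or a verbatim quotation of a PUBLISHED theorem with page reference. The manuscript(s) under audit are NOT citable for their own disputed
steps — they are the thing under adjudication; programme-internal (2001/route/tribunal) claims are never citable.»

WHERE THIS SITS (`HOME/b2b-balaban-beta-d1-p2/K-ASSEMBLY-SPEC-v2.md` v2.3 §2 row K-TB3c «GHOST LEGS ON THE TORUS → ℤ⁴», «OPEN — after K-TB3a»;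
`OWNER-MEMO-g6.md` §2; PART 1 = ne9-leaf-09-g38's `TorusGhostLegs` ∕ `TorusGhostGram`, whose docstrings leave «NOT HERE (K-TB3c PART 2):
`Q̂′·((Ggh)^)²·Q̂′ᵀ = n⁴•(KsqK)^` on the torus (scalar twin of 3b-Q(ii) `TorusAveragingGram`)»).  After K-TB3a (`GhostSplitJets` p239077 ∕
`GhostCompressionJets` p239613) the ghost side of the owner's DECISION 2 is consumed by TB5 through the THREE LEG SOCKETS of
`GhostSplitJets.hessT_kkt_sq_jets_of_mul_eq_one` — `kkt X₀ Q₀ * L = 1`, `M₀ * Gm = 1`, `S₀ * Gs = 1`, `X₀ = M₀·M₀`, `S₀ = Q₀·X₀⁻¹·Q₀ᵀ` — after the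
compression step `GhostCompressionJets.hessT_compressed_jets` (`Q·N = 0`, `det(Q·Qᵀ) ≠ 0`) and the shift step `hessT_kkt_shift_sq_jets`
(`M₀ = Δ₀ + Qᵀ(a₀Q)`).  At `U = 1` on the fine torus `Site 4 s`, `s = (m+1)·p` (pv23 block side `m+1`): `M₀ = ÂX`, `Gm = Ĝ′`
(`PeriodisedProjector.Ghat_mul_AXhat`, IN TREE); `Q₀` is the RECTANGULAR block-averaging matrix from the fine torus `Site 4 s` to the coarse torus
`Site 4 p` — two different tori, so NOT the periodisation of a `ℤ⁴` kernel — typed HERE as `Qind` with exactly the facts those sockets ask of it;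
FILE 2 identifies `S₀ = Qind·(ÂX·ÂX)⁻¹·Qindᵀ = (m+1)⁴•k̂erSq` and `Gs = (m+1)⁻⁴•Ĉsq`.
CONTENT (d = 4, pv23 block side `m+1`, `a > 0`, fine torus `Beta.Site 4 s`, coarse torus `Beta.Site 4 p`, `hs : s = (m+1)·p`):
* §1 [folklore] ON `ℤ⁴`: `summable_row_mul_col`, **`blockSum_compKer_Gk_Gk : blockSum m (G′∘G′) y y′ = (m+1)⁴·kerSq m a y y′`** (Fubini, `Gk_symm`, pv23's
  `kerSq = (m+1)⁻⁴ Σ′_r (G′Q′*)(r,y)(G′Q′*)(r,y′)`), `isPeriodic₂_kerSq`∕`isPeriodic₂_Csq` for EVERY period (full translation invariance, IN TREE as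
  `RJetProjector.kerSq_translate`∕`Csq_translate`), `rowBound_kerSq`∕`rowBound_Csq`, `compKer_kerSq_Csq`.
* §2 [our object] `kerSqHat m a p`, `CsqHat m a p`; [folklore] `Ghat_mul_Ghat` (product rule), **`Qind_Ghat_Ghat_Qind_transpose`** (FILE 1's two-scale unfold
  + §1), `inv_AXhat_mul_AXhat`, **`S0_letter`**, **`kerSqHat_mul_CsqHat`** (Lemma 2.2.2, both orders, every `p`), `kerSqHat_transpose`, `CsqHat_transpose`,
  **`S0_mul_inv_letter`**, `det_S0_ne_zero`, `inv_S0`; `AXhat_transpose`, `det_gram_conj_ne_zero` (`det B ≠ 0 ∧ det(NᵀN) ≠ 0 ⟹ det(Nᵀ(BᵀB)N) ≠ 0`),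
  **`det_compressed_AXhat_sq_ne_zero`** (the `hd` socket of `GhostCompressionJets.hessT_compressed_jets` at `X₀ = ÂX·ÂX`, any gauge basis `N`),
  `det_AXhat_ne_zero`, **`eq_zero_of_Lhat_and_Qind_mulVec`** (`L̂v = 0 ∧ Qind·v = 0 ⟹ v = 0`, no connectivity — the owner's (J4)
  device), **`det_compressed_lap_sq_ne_zero`** (`Qind·N = 0 ∧ det(NᵀN) ≠ 0 ⟹ det (Nᵀ·((m+1)²L̂)²·N) ≠ 0` — the `hd` socket AT THE LAPLACIAN SQUARE, where
  the compression is applied), **`det_kkt_AXhat_sq_Qind_ne_zero`** (`det (kkt (ÂX·ÂX) Qind) ≠ 0` by `Composition.det_kkt_ne_zero`, and the `hL` socket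
  `kkt · (kkt)⁻¹ = 1`).
* §3 [folklore] BRIDGES TO PART 1's `× Unit` ∕ road-`n` CURRENCY (`n = m+1`, `eU s : Site 4 s × Unit ≃ Site 4 s`, coercion `Prod.fst`):
  `periodiseF_Ggh_eq_submatrix_eU` (= `TorusGhostLegs.periodiseF_Ggh_eq_submatrix` BY NAME with the map bundled), `periodiseF_KsqK_eq_submatrix` ∕
  `periodiseF_CsqK_eq_submatrix` (`TorusGhostGram`'s `(KsqK n a)^` ∕ `(CsqK n a)^` ARE `k̂erSq` ∕ `Ĉsq` at `m = n − 1`, by `rfl`), [our object]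
  `QindU n s p := (Qind (n−1) s p).submatrix (eU p) (eU s)`, and **`S0_letter_unit : QindU·(Ggh n a)^·(Ggh n a)^·QindUᵀ = n⁴ • (KsqK n a)^`** — PART 1's
  advertised «`Q̂′·((Ggh)^)²·Q̂′ᵀ = n⁴•(KsqK)^`» verbatim — with **`S0_unit_mul_inv_letter`** (`… · (n⁻⁴ • (CsqK n a)^) = 1`, PART 1's coarse letter BY NAME)
  and `inv_S0_unit`.
NOT HERE: the S-JETS (`Sₛ`, `Sₜ`, `Sₛₜ` of `hessT_kkt_sq_jets`) as periodised coarse arrays of the unit-class Gram rows (dictionary of record, after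
TB4-tables); the `p → ∞` sockets (PART 1); the sorted `Site 4 p × (TorusSite 4 n × Unit)` re-indexing of the whole ghost side (TB5's call; FILE 1 §3 is the
junction).
Provenance: NE9 formalisation swarm leaf seat `b2b-balaban-t4-ne9-formalise-leaf-02` gen 26 (cross-row prover duty NE9 → β∕D1 road «BF-x»; journal CLAIM
«K-TB3c PART 2» l.22923), 2026-08-20.
-/

noncomputable section

namespace Summit.QuantumFields.BalabanUV.Beta.D1BFx.TorusScalarCoarseGram

open Finset Matrix
open scoped BigOperators
open Literature.MathematicalPhysics.QuantumFieldTheory.Balaban1983to89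
open Literature.MathematicalPhysics.QuantumFieldTheory.Balaban1983to89.Beta
open B6QGQLower276 (X B AX AX_symm lapKer lapKer_symm)
open Literature.MathematicalPhysics.QuantumFieldTheory.Balaban1983to89.Beta.Composition (kkt blockProp det_kkt_ne_zero)
open B6QGGQ278Zd (kerSq Csq cSq deltaSq cC deltaC cSq_pos deltaSq_pos cC_pos deltaC_pos abs_kerSq_le abs_Csq_le kerSq_symm)
open B5Hk103ScalarZd (Gk gq)
open B4Sect5Proof (latticeConst)
open ExpKernelCalculus (MKer)
open Summit.QuantumFields.BalabanUV.Beta.D1BFx.FibredPeriodisation (periodiseF isPeriodic₂_compKer summable_compKer)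
open Summit.QuantumFields.BalabanUV.Beta.D1BFx.PeriodicArrays (toF)
open Summit.QuantumFields.BalabanUV.Beta.D1BFx.GhostLeg (Ggh cast_pred_add_one)
open Summit.QuantumFields.BalabanUV.Beta.D1BFx.TorusGaugeWeight (Lhat_transpose)
open Summit.QuantumFields.BalabanUV.Beta.D1BFx.TorusGhostLegs (periodiseF_Ggh_eq_submatrix)
open Summit.QuantumFields.BalabanUV.Beta.D1BFx.TorusGhostGram (KsqK CsqK periodiseF_KsqK_mul_CsqK)
open Summit.QuantumFields.BalabanUV.Beta.D1BFx.RProjector (tsum_kerSq_mul_Csq Csq_symm)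
open Summit.QuantumFields.BalabanUV.Beta.D1BFx.RProjectorRange (Gk_symm)
open Summit.QuantumFields.BalabanUV.Beta.D1BFx.RJetProjector (kerSq_translate Csq_translate)
open Summit.QuantumFields.BalabanUV.Beta.D1BFx.PeriodisedKernels
open Summit.QuantumFields.BalabanUV.Beta.D1BFx.PeriodisedProjector
open Summit.QuantumFields.BalabanUV.Beta.D1BFx.TorusScalarAveraging

/-! ## §1 On `ℤ⁴`: the block sums of `G′ ∘ G′` are `(m+1)⁴ · (Q′G′²Q′*)` -/

section Lattice

variable (m : ℕ) {a : ℝ}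

omit m in
/-- [folklore] An absolutely summable row against a uniformly bounded column is summable. -/
theorem summable_row_mul_col {T S : Kernel₂ 4} {Bc : ℝ} {x : X 4} (hT : Summable fun y => |T x y|) (hS : RowBound S Bc) (z : X 4) :
    Summable fun y => T x y * S y z := by
  refine Summable.of_norm_bounded (g := fun y => |T x y| * Bc) (hT.mul_right Bc) fun y => ?_
  rw [Real.norm_eq_abs, abs_mul]
  exact mul_le_mul_of_nonneg_left (hS.abs_le y z) (abs_nonneg _)

/-- [folklore] **`Σ_{x ∈ B(y)} Σ_{x′ ∈ B(y′)} (G′∘G′)(x, x′) = (m+1)⁴ · (Q′G′²Q′*)(y, y′)`** — Fubini, the symmetry of `G′`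
(`RProjectorRange.Gk_symm`) and pv23's `kerSq m a y y′ = (m+1)⁻⁴ Σ′_r (G′Q′*)(r,y)(G′Q′*)(r,y′)`. -/
theorem blockSum_compKer_Gk_Gk (ha : 0 < a) (y y' : X 4) :
    blockSum m (compKer (Gk (d := 4) m a) (Gk m a)) y y' = ((m : ℝ) + 1) ^ 4 * kerSq m a y y' := by
  have hsum : ∀ x x' : X 4, Summable fun r : X 4 => Gk m a x r * Gk m a r x' := fun x x' =>
    summable_row_mul_col (summable_abs_row_Gk m ha x) (rowBound_Gk m ha) x'
  simp only [blockSum, compKer]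
  rw [Finset.sum_congr rfl fun x _ => (Summable.tsum_finsetSum fun x' _ => hsum x x').symm,
    ← Summable.tsum_finsetSum fun x _ => summable_sum fun x' _ => hsum x x']
  have e2 : ∀ r : X 4, ∑ x ∈ B m y, ∑ x' ∈ B m y', Gk m a x r * Gk m a r x' = gq m a r y * gq m a r y' := fun r => by
    rw [← Finset.sum_mul_sum]
    simp only [gq]
    congr 1
    exact Finset.sum_congr rfl fun x _ => Gk_symm m ha x r
  rw [tsum_congr e2, kerSq, ← mul_assoc, mul_inv_cancel₀ (by positivity), one_mul]

/-- [folklore] `Q′G′²Q′*` is jointly `q`-periodic for EVERY `q` (full translation invariance, `RJetProjector.kerSq_translate`). -/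
theorem isPeriodic₂_kerSq (ha : 0 < a) (q : ℕ) : IsPeriodic₂ q (kerSq (d := 4) m a) :=
  IsPeriodic₂.of_transInv (fun x y v => kerSq_translate m ha v x y) q

/-- [folklore] «the operator C» is jointly `q`-periodic for EVERY `q` (`RJetProjector.Csq_translate`). -/
theorem isPeriodic₂_Csq (ha : 0 < a) (q : ℕ) : IsPeriodic₂ q (Csq (d := 4) m a) :=
  IsPeriodic₂.of_transInv (fun x y v => Csq_translate m ha v x y) q

/-- [folklore] Row bound of `Q′G′²Q′*` (`B6QGGQ278Zd.abs_kerSq_le`). -/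
theorem rowBound_kerSq (ha : 0 < a) : RowBound (kerSq (d := 4) m a) (cSq 4 a * latticeConst 4 (deltaSq 4 a)) :=
  rowBound_of_site_decay (deltaSq_pos 4 ha) (cSq_pos 4 ha).le fun y y' => abs_kerSq_le m ha y y'

/-- [folklore] Row bound of `C` (`B6QGGQ278Zd.abs_Csq_le`). -/
theorem rowBound_Csq (ha : 0 < a) : RowBound (Csq (d := 4) m a) (cC 4 a * latticeConst 4 (deltaC 4 a)) :=
  rowBound_of_site_decay (deltaC_pos 4 ha) (cC_pos 4 ha).le fun y y' => abs_Csq_le m ha y y'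

/-- [folklore] `(Q′G′²Q′*) ∘ C = δ` as kernels (`RProjector.tsum_kerSq_mul_Csq`). -/
theorem compKer_kerSq_Csq (ha : 0 < a) : compKer (kerSq (d := 4) m a) (Csq m a) = kdelta := by
  funext y z; exact tsum_kerSq_mul_Csq m ha y z

end Lattice

/-! ## §2 THE `S₀`-LETTER on the coarse torus -/

/-- [our object] **`k̂erSq := (periodise₂ p (Q′G′²Q′*))^`** — the coarse-torus matrix of pv23's `kerSq`. -/
def kerSqHat (m : ℕ) (a : ℝ) (p : ℕ) [NeZero p] : Matrix (Site 4 p) (Site 4 p) ℝ := Matrix.of (periodise₂ p (kerSq (d := 4) m a))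

/-- [our object] **`Ĉsq := (periodise₂ p C)^`** — the coarse-torus matrix of «the operator C». -/
def CsqHat (m : ℕ) (a : ℝ) (p : ℕ) [NeZero p] : Matrix (Site 4 p) (Site 4 p) ℝ := Matrix.of (periodise₂ p (Csq (d := 4) m a))

section Letter

variable (m : ℕ) {a : ℝ} {s p : ℕ} [NeZero s] [NeZero p]

omit [NeZero s] in
/-- [folklore] Entries of `kerSqHat`. -/
@[simp] theorem kerSqHat_apply (yb yb' : Site 4 p) : kerSqHat m a p yb yb' = periodise₂ p (kerSq (d := 4) m a) yb yb' := rfl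
omit [NeZero s] in
/-- [folklore] Entries of `CsqHat`. -/
@[simp] theorem CsqHat_apply (yb yb' : Site 4 p) : CsqHat m a p yb yb' = periodise₂ p (Csq (d := 4) m a) yb yb' := rfl

omit [NeZero p] in
/-- [folklore] **`Ĝ′·Ĝ′ = (periodise₂ s (G′∘G′))^`** (an4's product rule). -/
theorem Ghat_mul_Ghat (ha : 0 < a) (hs : s = (m + 1) * p) :
    Ghat m a s * Ghat m a s = Matrix.of (periodise₂ s (compKer (Gk (d := 4) m a) (Gk m a))) := by
  ext x z
  rw [Matrix.mul_apply, Matrix.of_apply]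
  simp only [Ghat_apply]
  rw [← periodise₂_compKer (summable_abs_row_Gk m ha) (isPeriodic₂_Gk m ha (hdiv_of_hs hs)) (rowBound_Gk m ha)]

/-- [folklore] **THE COARSE GRAM OF THE SCALAR TOWER ON THE TORUS: `Qind·Ĝ′·Ĝ′·Qindᵀ = (m+1)⁴ • k̂erSq`** — the scalar twin of
`TorusAveragingGram.Qhat_mul_Ghat_mul_QhatT`. -/
theorem Qind_Ghat_Ghat_Qind_transpose (ha : 0 < a) (hs : s = (m + 1) * p) :
    Qind m s p * Ghat m a s * Ghat m a s * (Qind m s p)ᵀ = (((m : ℝ) + 1) ^ 4) • kerSqHat m a p := by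
  have hdiv := hdiv_of_hs hs
  rw [Matrix.mul_assoc (Qind m s p), Ghat_mul_Ghat m ha hs,
    Qind_mul_periodise₂_mul_Qind_transpose m hs (isPeriodic₂_compKer (isPeriodic₂_Gk m ha hdiv) (isPeriodic₂_Gk m ha hdiv))
      (fun x => summable_compKer (summable_abs_row_Gk m ha x) (rowBound_Gk m ha))]
  have e : blockSum m (compKer (Gk (d := 4) m a) (Gk m a)) = fun y y' => ((m : ℝ) + 1) ^ 4 * kerSq m a y y' :=
    funext fun y => funext fun y' => blockSum_compKer_Gk_Gk m ha y y'
  ext yb yb'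
  rw [Matrix.of_apply, e, periodise₂_const_mul, Matrix.smul_apply, kerSqHat_apply, smul_eq_mul]

omit [NeZero p] in
/-- [folklore] **`(ÂX·ÂX)⁻¹ = Ĝ′·Ĝ′`** (`PeriodisedProjector.Ghat_mul_AXhat`). -/
theorem inv_AXhat_mul_AXhat (ha : 0 < a) (hs : s = (m + 1) * p) :
    (AXhat m a s * AXhat m a s)⁻¹ = Ghat m a s * Ghat m a s := by
  have h := (Ghat_mul_AXhat (m := m) (a := a) (s := s) ha hs).2
  refine Matrix.inv_eq_right_inv ?_
  rw [Matrix.mul_assoc, ← Matrix.mul_assoc (AXhat m a s) (Ghat m a s), h, Matrix.one_mul, h]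

/-- [folklore] **THE `S₀`-LETTER**: `Qind·(ÂX·ÂX)⁻¹·Qindᵀ = (m+1)⁴ • k̂erSq` — literally the `hS₀ : S₀ = Q₀·X₀⁻¹·Q₀ᵀ` datum of
`GhostSplitJets.hessT_kkt_sq_jets` at `U = 1` with `M₀ = ÂX`, `X₀ = ÂX·ÂX`, `Q₀ = Qind`. -/
theorem S0_letter (ha : 0 < a) (hs : s = (m + 1) * p) :
    Qind m s p * (AXhat m a s * AXhat m a s)⁻¹ * (Qind m s p)ᵀ = (((m : ℝ) + 1) ^ 4) • kerSqHat m a p := by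
  rw [inv_AXhat_mul_AXhat m ha hs, ← Matrix.mul_assoc, Qind_Ghat_Ghat_Qind_transpose m ha hs]

omit [NeZero s] in
/-- [folklore] **THE COARSE LETTER `k̂erSq·Ĉsq = 1 = Ĉsq·k̂erSq`** on EVERY coarse torus (an4's Lemma 2.2.2; no divisibility condition: both kernels
are fully translation invariant). -/
theorem kerSqHat_mul_CsqHat (ha : 0 < a) : kerSqHat m a p * CsqHat m a p = 1 ∧ CsqHat m a p * kerSqHat m a p = 1 :=
  lemma222_periodic (rowBound_kerSq m ha).summable_abs (isPeriodic₂_Csq m ha p) (rowBound_Csq m ha) (compKer_kerSq_Csq m ha)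

omit [NeZero s] in
/-- [folklore] `k̂erSq` is symmetric. -/
theorem kerSqHat_transpose (ha : 0 < a) : (kerSqHat m a p)ᵀ = kerSqHat m a p := by
  ext yb yb'
  rw [Matrix.transpose_apply, kerSqHat_apply, kerSqHat_apply]
  exact (periodise₂_symm (isPeriodic₂_kerSq m ha p) (fun y y' => kerSq_symm m a y y') yb yb').symm

omit [NeZero s] in
/-- [folklore] `Ĉsq` is symmetric. -/
theorem CsqHat_transpose (ha : 0 < a) : (CsqHat m a p)ᵀ = CsqHat m a p := by
  ext yb yb'
  rw [Matrix.transpose_apply, CsqHat_apply, CsqHat_apply]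
  exact (periodise₂_symm (isPeriodic₂_Csq m ha p) (fun y y' => Csq_symm m ha y y') yb yb').symm

/-- [folklore] **THE `S₀⁻¹`-SOCKET**: `S₀ · ((m+1)⁻⁴ • Ĉsq) = 1` — the `hGs` datum of `GhostSplitJets.hessT_kkt_sq_jets_of_mul_eq_one`. -/
theorem S0_mul_inv_letter (ha : 0 < a) (hs : s = (m + 1) * p) :
    (Qind m s p * (AXhat m a s * AXhat m a s)⁻¹ * (Qind m s p)ᵀ) * ((((m : ℝ) + 1) ^ 4)⁻¹ • CsqHat m a p) = 1 := by
  rw [S0_letter m ha hs, Matrix.smul_mul, Matrix.mul_smul, smul_smul, (kerSqHat_mul_CsqHat m ha).1,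
    mul_inv_cancel₀ (by positivity), one_smul]

/-- [folklore] `det S₀ ≠ 0` — the `hS` datum of `GhostSplitJets.hessT_kkt_sq_jets`. -/
theorem det_S0_ne_zero (ha : 0 < a) (hs : s = (m + 1) * p) :
    (Qind m s p * (AXhat m a s * AXhat m a s)⁻¹ * (Qind m s p)ᵀ).det ≠ 0 :=
  (Matrix.isUnit_det_of_right_inverse (S0_mul_inv_letter m ha hs)).ne_zero

/-- [folklore] `S₀⁻¹ = (m+1)⁻⁴ • Ĉsq`. -/
theorem inv_S0 (ha : 0 < a) (hs : s = (m + 1) * p) :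
    (Qind m s p * (AXhat m a s * AXhat m a s)⁻¹ * (Qind m s p)ᵀ)⁻¹ = (((m : ℝ) + 1) ^ 4)⁻¹ • CsqHat m a p :=
  Matrix.inv_eq_right_inv (S0_mul_inv_letter m ha hs)

omit [NeZero p] in
/-- [folklore] **`ÂXᵀ = ÂX`** (`periodise₂_symm` + `AX_symm`). -/
theorem AXhat_transpose (a : ℝ) (hs : s = (m + 1) * p) : (AXhat m a s)ᵀ = AXhat m a s := by
  ext x z
  rw [Matrix.transpose_apply, AXhat_apply, AXhat_apply]
  exact (periodise₂_symm (isPeriodic₂_AX m a (hdiv_of_hs hs)) (fun y y' => AX_symm m a y y') x z).symm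

omit [NeZero s] [NeZero p] in
/-- [folklore] **A GRAM MATRIX THROUGH AN INVERTIBLE MATRIX KEEPS FULL COLUMN RANK**: `det B ≠ 0`, `det (NᵀN) ≠ 0` ⟹ `det (Nᵀ(BᵀB)N) ≠ 0`
(over `ℝ`: `Nᵀ(BᵀB)N v = 0 ⟹ ‖BNv‖² = 0 ⟹ Nv = 0 ⟹ NᵀN v = 0 ⟹ v = 0`). -/
theorem det_gram_conj_ne_zero {ι ρ : Type*} [Fintype ι] [Fintype ρ] [DecidableEq ι] [DecidableEq ρ] (B : Matrix ι ι ℝ) (N : Matrix ι ρ ℝ)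
    (hB : B.det ≠ 0) (hN : (Nᵀ * N).det ≠ 0) : (Nᵀ * (Bᵀ * B) * N).det ≠ 0 := by
  intro h0
  obtain ⟨v, hv, hmul⟩ := Matrix.exists_mulVec_eq_zero_iff.2 h0
  -- `‖B N v‖² = vᵀ Nᵀ Bᵀ B N v = 0`
  have hsq : (B *ᵥ (N *ᵥ v)) ⬝ᵥ (B *ᵥ (N *ᵥ v)) = 0 := by
    have e : (Nᵀ * (Bᵀ * B) * N) *ᵥ v = Nᵀ *ᵥ (Bᵀ *ᵥ (B *ᵥ (N *ᵥ v))) := by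
      simp only [← Matrix.mulVec_mulVec, Matrix.mul_assoc]
    have h1 : v ⬝ᵥ ((Nᵀ * (Bᵀ * B) * N) *ᵥ v) = 0 := by rw [hmul, dotProduct_zero]
    rwa [e, Matrix.dotProduct_mulVec, Matrix.vecMul_transpose, Matrix.dotProduct_mulVec, Matrix.vecMul_transpose] at h1
  have hBNv : B *ᵥ (N *ᵥ v) = 0 := dotProduct_self_eq_zero.1 hsq
  have hNv : N *ᵥ v = 0 := by
    by_contra hne
    exact hB (Matrix.exists_mulVec_eq_zero_iff.1 ⟨N *ᵥ v, hne, hBNv⟩)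
  have hNNv : (Nᵀ * N) *ᵥ v = 0 := by rw [← Matrix.mulVec_mulVec, hNv, Matrix.mulVec_zero]
  exact hN (Matrix.exists_mulVec_eq_zero_iff.1 ⟨v, hv, hNNv⟩)

omit [NeZero p] in
/-- [folklore] **THE COMPRESSION SOCKET at `U = 1`**: for any gauge basis `N` with `det (NᵀN) ≠ 0`, `det (Nᵀ·(ÂX·ÂX)·N) ≠ 0` — the `hd` datum of
`GhostCompressionJets.hessT_compressed_jets` with `X₀ = ÂX·ÂX` (`ÂX` symmetric and invertible). -/
theorem det_compressed_AXhat_sq_ne_zero {ρ : Type*} [Fintype ρ] [DecidableEq ρ] (ha : 0 < a) (hs : s = (m + 1) * p) (N : Matrix (Site 4 s) ρ ℝ)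
    (hN : (Nᵀ * N).det ≠ 0) : (Nᵀ * (AXhat m a s * AXhat m a s) * N).det ≠ 0 := by
  have hdet : (AXhat m a s).det ≠ 0 := (Matrix.isUnit_det_of_right_inverse (Ghat_mul_AXhat (m := m) (a := a) (s := s) ha hs).2).ne_zero
  have h := det_gram_conj_ne_zero (AXhat m a s) N hdet hN
  rwa [AXhat_transpose m a hs] at h

omit [NeZero p] in
/-- [folklore] `det (ÂX·ÂX) ≠ 0` and `det ÂX ≠ 0`. -/
theorem det_AXhat_ne_zero (ha : 0 < a) (hs : s = (m + 1) * p) : (AXhat m a s).det ≠ 0 ∧ (AXhat m a s * AXhat m a s).det ≠ 0 := by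
  have hdet : (AXhat m a s).det ≠ 0 := (Matrix.isUnit_det_of_right_inverse (Ghat_mul_AXhat (m := m) (a := a) (s := s) ha hs).2).ne_zero
  exact ⟨hdet, by rw [Matrix.det_mul]; exact mul_ne_zero hdet hdet⟩

/-- [folklore] **`L̂v = 0 ∧ Qind·v = 0 ⟹ v = 0` WITHOUT CONNECTIVITY** (the owner's (J4) device): `ÂX·v = (m+1)²·L̂v + Qindᵀ((a/(m+1)⁴)•1)Qind·v = 0` and
`Ĝ′·ÂX = 1`. -/
theorem eq_zero_of_Lhat_and_Qind_mulVec (ha : 0 < a) (hs : s = (m + 1) * p) {v : Site 4 s → ℝ} (hL : Lhat s *ᵥ v = 0) (hQ : Qind m s p *ᵥ v = 0) :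
    v = 0 := by
  have hAX : AXhat m a s *ᵥ v = 0 := by
    rw [AXhat_eq_lap_add_border (m := m) a hs, Matrix.add_mulVec, Matrix.smul_mulVec, hL, smul_zero, zero_add, ← Matrix.mulVec_mulVec, hQ,
      Matrix.mulVec_zero]
  have h := congrArg (fun w => Ghat m a s *ᵥ w) hAX
  simp only [Matrix.mulVec_mulVec, (Ghat_mul_AXhat (m := m) (a := a) (s := s) ha hs).1, Matrix.one_mulVec, Matrix.mulVec_zero] at h
  exact h

/-- [folklore] **THE COMPRESSION SOCKET OF THE LAPLACIAN SQUARE** (`X₀ = Δ₀·Δ₀`, `Δ₀ = (m+1)²•L̂`, the shape `GhostCompressionJets.hessT_compressed_jets` is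
APPLIED in, before the shift): for any `N` with `Qind·N = 0` and `det (NᵀN) ≠ 0`, `det (Nᵀ·(Δ₀·Δ₀)·N) ≠ 0` — `Δ₀Nv = 0 ⟹ Nv = 0` by the previous lemma,
no spectral or connectivity input. -/
theorem det_compressed_lap_sq_ne_zero {ρ : Type*} [Fintype ρ] [DecidableEq ρ] (ha : 0 < a) (hs : s = (m + 1) * p) (N : Matrix (Site 4 s) ρ ℝ)
    (hQN : Qind m s p * N = 0) (hN : (Nᵀ * N).det ≠ 0) :
    (Nᵀ * ((((m : ℝ) + 1) ^ 2 • Lhat s) * (((m : ℝ) + 1) ^ 2 • Lhat s)) * N).det ≠ 0 := by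
  intro h0
  obtain ⟨v, hv, hmul⟩ := Matrix.exists_mulVec_eq_zero_iff.2 h0
  set D : Matrix (Site 4 s) (Site 4 s) ℝ := ((m : ℝ) + 1) ^ 2 • Lhat s with hD
  have hDt : Dᵀ = D := by rw [hD, Matrix.transpose_smul, Lhat_transpose]
  have hsq : (D *ᵥ (N *ᵥ v)) ⬝ᵥ (D *ᵥ (N *ᵥ v)) = 0 := by
    have e : (Nᵀ * (D * D) * N) *ᵥ v = Nᵀ *ᵥ (Dᵀ *ᵥ (D *ᵥ (N *ᵥ v))) := by
      simp only [← Matrix.mulVec_mulVec, Matrix.mul_assoc, hDt]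
    have h1 : v ⬝ᵥ ((Nᵀ * (D * D) * N) *ᵥ v) = 0 := by rw [hmul, dotProduct_zero]
    rwa [e, Matrix.dotProduct_mulVec, Matrix.vecMul_transpose, Matrix.dotProduct_mulVec, Matrix.vecMul_transpose] at h1
  have hDNv : D *ᵥ (N *ᵥ v) = 0 := dotProduct_self_eq_zero.1 hsq
  have hL : Lhat s *ᵥ (N *ᵥ v) = 0 := by
    have hc : (((m : ℝ) + 1) ^ 2) ≠ 0 := by positivity
    have : (((m : ℝ) + 1) ^ 2) • (Lhat s *ᵥ (N *ᵥ v)) = 0 := by rw [← Matrix.smul_mulVec]; exact hDNv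
    exact (smul_eq_zero.1 this).resolve_left hc
  have hQ : Qind m s p *ᵥ (N *ᵥ v) = 0 := by rw [Matrix.mulVec_mulVec, hQN, Matrix.zero_mulVec]
  have hNv : N *ᵥ v = 0 := eq_zero_of_Lhat_and_Qind_mulVec m ha hs hL hQ
  have hNNv : (Nᵀ * N) *ᵥ v = 0 := by rw [← Matrix.mulVec_mulVec, hNv, Matrix.mulVec_zero]
  exact hN (Matrix.exists_mulVec_eq_zero_iff.1 ⟨v, hv, hNNv⟩)

/-- [folklore] **THE BORDERED SOCKET**: `det (kkt (ÂX·ÂX) Qind) ≠ 0` (Schur complement `Composition.det_kkt_ne_zero`: `det (ÂX·ÂX) ≠ 0` and the block propagator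
`Qind·(ÂX·ÂX)⁻¹·Qindᵀ = S₀` has `det S₀ ≠ 0`), hence `kkt (ÂX·ÂX) Qind · (kkt (ÂX·ÂX) Qind)⁻¹ = 1` — the `hL` socket of
`GhostSplitJets.hessT_kkt_sq_jets_of_mul_eq_one` with `L := (kkt X₀ Q₀)⁻¹`. -/
theorem det_kkt_AXhat_sq_Qind_ne_zero (ha : 0 < a) (hs : s = (m + 1) * p) :
    (kkt (AXhat m a s * AXhat m a s) (Qind m s p)).det ≠ 0 ∧
      kkt (AXhat m a s * AXhat m a s) (Qind m s p) * (kkt (AXhat m a s * AXhat m a s) (Qind m s p))⁻¹ = 1 := by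
  have h1 : IsUnit (AXhat m a s * AXhat m a s).det := isUnit_iff_ne_zero.2 (det_AXhat_ne_zero m ha hs).2
  have h2 : IsUnit (blockProp (AXhat m a s * AXhat m a s) (Qind m s p)).det := isUnit_iff_ne_zero.2 (det_S0_ne_zero m ha hs)
  have h := det_kkt_ne_zero _ _ h1 h2
  exact ⟨h, Matrix.mul_nonsing_inv _ (isUnit_iff_ne_zero.2 h)⟩

end Letter

/-! ## §3 Bridges to the `× Unit` ∕ road-`n` currency of K-TB3c PART 1 (`TorusGhostLegs.Ggh^`, `TorusGhostGram.KsqK^ ∕ CsqK^`) -/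

section Bridge

variable (n : ℕ) [NeZero n] (a : ℝ) (s p : ℕ) [NeZero s] [NeZero p]

/-- [our object] The trivial-fibre reading `Site 4 s × Unit ≃ Site 4 s` (`Equiv.prodPUnit`; its coercion is `Prod.fst`). -/
abbrev eU (s : ℕ) : Site 4 s × Unit ≃ Site 4 s := Equiv.prodPUnit (Site 4 s)

omit [NeZero p] in
/-- [folklore] PART 1's `TorusGhostLegs.periodiseF_Ggh_eq_submatrix` (`(Ggh n a)^ = Ĝ′.submatrix Prod.fst Prod.fst`, by `rfl`) with the re-indexing map
bundled as the equivalence `eU s` (what `Matrix.submatrix_mul_equiv` wants) — the same term. -/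
theorem periodiseF_Ggh_eq_submatrix_eU : Matrix.of (periodiseF s (toF (Ggh n a))) = (Ghat (n - 1) a s).submatrix (eU s) (eU s) :=
  periodiseF_Ggh_eq_submatrix n a

omit [NeZero s] [NeZero n] in
/-- [folklore] **PART 1's `(KsqK n a)^` IS `k̂erSq` read through the trivial fibre**: `Matrix.of (periodiseF p (toF (KsqK n a))) = (kerSqHat (n−1) a p).submatrix
(eU p) (eU p)` (definitional). -/
theorem periodiseF_KsqK_eq_submatrix : Matrix.of (periodiseF p (toF (KsqK n a))) = (kerSqHat (n - 1) a p).submatrix (eU p) (eU p) := by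
  ext ⟨x, u⟩ ⟨y, v⟩; rfl

omit [NeZero s] [NeZero n] in
/-- [folklore] … and `(CsqK n a)^ = Ĉsq.submatrix (eU p) (eU p)` (definitional). -/
theorem periodiseF_CsqK_eq_submatrix : Matrix.of (periodiseF p (toF (CsqK n a))) = (CsqHat (n - 1) a p).submatrix (eU p) (eU p) := by
  ext ⟨x, u⟩ ⟨y, v⟩; rfl

/-- [our object] **`QindU`** — the block indicator between the `× Unit`-decorated tori of PART 1 (`Qind (n−1) s p` re-indexed by `eU`). -/
abbrev QindU (n s p : ℕ) [NeZero s] : Matrix (Site 4 p × Unit) (Site 4 s × Unit) ℝ := (Qind (n - 1) s p).submatrix (eU p) (eU s)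

/-- [folklore] **THE `S₀`-LETTER IN PART 1's CURRENCY** (`s = n·p`): `QindU · (Ggh n a)^ · (Ggh n a)^ · QindUᵀ = n⁴ • (KsqK n a)^` — PART 1's advertised
«`Q̂′·((Ggh)^)²·Q̂′ᵀ = n⁴•(KsqK)^`», verbatim. -/
theorem S0_letter_unit (ha : 0 < a) (hs : s = n * p) :
    QindU n s p * Matrix.of (periodiseF s (toF (Ggh n a))) * Matrix.of (periodiseF s (toF (Ggh n a))) * (QindU n s p)ᵀ
      = ((n : ℝ) ^ 4) • Matrix.of (periodiseF p (toF (KsqK n a))) := by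
  have hs' : s = (n - 1 + 1) * p := by rw [Nat.sub_add_cancel NeZero.one_le]; exact hs
  rw [periodiseF_KsqK_eq_submatrix, periodiseF_Ggh_eq_submatrix_eU, QindU, Matrix.transpose_submatrix, Matrix.submatrix_mul_equiv,
    Matrix.submatrix_mul_equiv, Matrix.submatrix_mul_equiv, Qind_Ghat_Ghat_Qind_transpose (n - 1) ha hs', Matrix.submatrix_smul, cast_pred_add_one n]
  rfl

/-- [folklore] **THE `S₀⁻¹`-SOCKET IN PART 1's CURRENCY**: `(QindU·(Ggh)^·(Ggh)^·QindUᵀ) · (n⁻⁴ • (CsqK n a)^) = 1` (PART 1's coarse letter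
`TorusGhostGram.periodiseF_KsqK_mul_CsqK` BY NAME). -/
theorem S0_unit_mul_inv_letter (ha : 0 < a) (hs : s = n * p) :
    (QindU n s p * Matrix.of (periodiseF s (toF (Ggh n a))) * Matrix.of (periodiseF s (toF (Ggh n a))) * (QindU n s p)ᵀ)
        * (((n : ℝ) ^ 4)⁻¹ • Matrix.of (periodiseF p (toF (CsqK n a)))) = 1 := by
  have hn : (n : ℝ) ^ 4 ≠ 0 := pow_ne_zero _ (by exact_mod_cast NeZero.ne n)
  rw [S0_letter_unit n a s p ha hs, Matrix.smul_mul, Matrix.mul_smul, smul_smul, (periodiseF_KsqK_mul_CsqK n a (q := p) ha).1,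
    mul_inv_cancel₀ hn, one_smul]

/-- [folklore] `(QindU·(Ggh)^·(Ggh)^·QindUᵀ)⁻¹ = n⁻⁴ • (CsqK n a)^` and its determinant is non-zero. -/
theorem inv_S0_unit (ha : 0 < a) (hs : s = n * p) :
    (QindU n s p * Matrix.of (periodiseF s (toF (Ggh n a))) * Matrix.of (periodiseF s (toF (Ggh n a))) * (QindU n s p)ᵀ)⁻¹
        = ((n : ℝ) ^ 4)⁻¹ • Matrix.of (periodiseF p (toF (CsqK n a))) ∧
      (QindU n s p * Matrix.of (periodiseF s (toF (Ggh n a))) * Matrix.of (periodiseF s (toF (Ggh n a))) * (QindU n s p)ᵀ).det ≠ 0 :=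
  ⟨Matrix.inv_eq_right_inv (S0_unit_mul_inv_letter n a s p ha hs), (Matrix.isUnit_det_of_right_inverse (S0_unit_mul_inv_letter n a s p ha hs)).ne_zero⟩

end Bridge

end Summit.QuantumFields.BalabanUV.Beta.D1BFx.TorusScalarCoarseGram

end
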